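import Literature.Probability.LatticeModels.SubcriticalFourier
import HarnessLib

/-!
# The Fejér kernel: closed form, positivity, decay, scaling, discrete mass, and the separable `d`-dimensional kernel

Topic `Literature/Probability/LatticeModels` (harmonic-analysis toolkit for the sliding-scale
infrared bound); family `crit-ising`. No named fact, no sorry. Elementary and self-contained.

Aizenman–Duminil-Copin 2021 prove Thm 5.6 (the sliding-scale infrared bound,
`aizenmanDuminilCopin_slidingScaleInfraredBound`) by testing the Fourier transform `Ŝ_β` of the
two-point function against smooth bumps at two scales ("`χ_L(β)` and `χ_ℓ(β)` are comparable to
averages of `Ŝ` over boxes of sizes `1/L` and `1/ℓ`", arXiv:1912.07973 p. 19–20). The tree's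
version of this argument uses the **Fejér kernel** as the bump: its lattice side
`F_L(x) = ∏ᵢ (1 - |xᵢ|/L)_+` is comparable to the indicator of the box `Λ_L`, and its momentum side
`F̂_L(p) = ∏ᵢ f_L(pᵢ)`, `f_L(u) = |∑_{n<L} e^{inu}|²/L = sin²(Lu/2)/(L sin²(u/2))`, is nonnegative with
explicit decay and scaling. This file provides exactly these facts:

* `fejerCount L k = #{(n,m) ∈ [0,L)² : n − m = k}` (`= (L − |k|)_+`) with `≤ L`, `= L` at `0`,
  `= 0` for `|k| ≥ L`, even, `≥ L − |k|`; the autocorrelation identity `sum_range_sum_range_sub_eq`;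
* `fejerKernel L u = |D_L(u)|²/L` (`dirichletSum`), `fejerKernel_eq_sum_cos`
  (`= (1/L)∑_k c_L(k) cos(ku)`), `0 ≤ f_L ≤ L`, the closed form `norm_dirichletSum_eq`, the decay
  `fejerKernel_le_div_sq` (`f_L(u) ≤ π²/(Lu²)`, `0 < |u| ≤ π`, via Jordan's inequality), the scaling
  `fejerKernel_mul_le` (`f_{λℓ}(u) ≤ (π²/4) λ f_ℓ(λu)`, `|u| ≤ π`) and the discrete mass
  `sum_fejerKernel_zmod` (`∑_{t ∈ ℤ/Λℤ} f_L(2πt/Λ) = Λ`, `1 ≤ L < Λ`);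
* the separable kernel `fejerBox` / `fejerBoxHat` with `0 ≤ F_L ≤ 1`, `F_L(0) = 1`, evenness,
  support in `Λ_L`, `F_L ≥ 2^{-d}` on the half box, `F̂_L = ∑_x F_L(x) cos(p·x)` (`fejerBoxHat_eq_sum`),
  `0 ≤ F̂_L ≤ L^d`, scaling `fejerBoxHat_mul_le` and discrete mass `sum_fejerBoxHat_torus`.

## References

* M. Aizenman, H. Duminil-Copin, Ann. of Math. 194 (2021) = arXiv:1912.07973, proof of Thm 5.6
  (p. 19–20) [AizenmanDuminilCopinAnnals2021] (the role of the bump functions).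
* Y. Katznelson, *An introduction to harmonic analysis*, 3rd ed. (2004), Ch. I §2.5 (Fejér's kernel) [folklore].

## Mathlib

`geom_sum_eq`, `Complex.norm_exp_I_mul_ofReal_sub_one`, `Real.mul_le_sin` (Jordan), `AddChar.sum_mulShift`,
`ZMod.isPrimitive_stdAddChar`, `Finset.prod_univ_sum`, `Finset.sum_fiberwise_of_maps_to`.
-/

noncomputable section

open Finset Complex Filter Topology
open scoped ComplexConjugate

namespace Literature.Probability.LatticeModels

/-! ### Part 1. The one-dimensional Fejér kernel as an autocorrelation -/

section OneDim

/-- The **Fejér counts** `c_L(k) = #{(n, m) ∈ [0, L)² : n - m = k}` (`= (L - |k|)_+`): the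
autocorrelation of the indicator of `[0, L)`, i.e. `L` times the Fejér weight `(1 - |k|/L)_+`. [folklore] -/
def fejerCount (L : ℕ) (k : ℤ) : ℕ :=
  ((Finset.range L ×ˢ Finset.range L).filter fun nm => (nm.1 : ℤ) - nm.2 = k).card

/-- **Autocorrelation sums**: `∑_{n,m<L} g(n - m) = ∑_{|k| ≤ L} c_L(k) g(k)`. [folklore] -/
theorem sum_range_sum_range_sub_eq {M : Type*} [AddCommMonoid M] (g : ℤ → M) (L : ℕ) :
    ∑ n ∈ Finset.range L, ∑ m ∈ Finset.range L, g ((n : ℤ) - m) =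
      ∑ k ∈ Finset.Icc (-(L : ℤ)) L, fejerCount L k • g k := by
  rw [← Finset.sum_product (s := Finset.range L) (t := Finset.range L) (f := fun nm => g ((nm.1 : ℤ) - nm.2)),
    ← Finset.sum_fiberwise_of_maps_to (s := Finset.range L ×ˢ Finset.range L) (t := Finset.Icc (-(L : ℤ)) L)
      (g := fun nm => (nm.1 : ℤ) - nm.2)]
  · refine Finset.sum_congr rfl fun k _ => ?_
    rw [fejerCount, ← Finset.sum_const]
    refine Finset.sum_congr rfl fun nm hnm => ?_
    rw [(Finset.mem_filter.1 hnm).2]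
  · intro nm hnm
    simp only [Finset.mem_product, Finset.mem_range] at hnm
    simp only [Finset.mem_Icc]
    omega

/-- `c_L(k) ≤ L`. [folklore] -/
theorem fejerCount_le (L : ℕ) (k : ℤ) : fejerCount L k ≤ L := by
  unfold fejerCount
  calc ((Finset.range L ×ˢ Finset.range L).filter fun nm => (nm.1 : ℤ) - nm.2 = k).card
      ≤ ((Finset.range L).image fun m : ℕ => (((m : ℤ) + k).toNat, m)).card := by
        refine Finset.card_le_card fun nm hnm => ?_
        simp only [Finset.mem_filter, Finset.mem_product, Finset.mem_range] at hnm
        simp only [Finset.mem_image, Finset.mem_range]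
        refine ⟨nm.2, hnm.1.2, ?_⟩
        have : ((nm.2 : ℤ) + k).toNat = nm.1 := by omega
        rw [this]
    _ ≤ (Finset.range L).card := Finset.card_image_le
    _ = L := Finset.card_range L

/-- `c_L(0) = L`. [folklore] -/
theorem fejerCount_zero (L : ℕ) : fejerCount L 0 = L := by
  unfold fejerCount
  have : ((Finset.range L ×ˢ Finset.range L).filter fun nm => (nm.1 : ℤ) - nm.2 = 0) =
      (Finset.range L).image fun m => (m, m) := by
    ext ⟨n, m⟩
    simp only [Finset.mem_filter, Finset.mem_product, Finset.mem_range, Finset.mem_image, Prod.mk.injEq]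
    constructor
    · rintro ⟨⟨hn, hm⟩, h⟩; exact ⟨m, hm, by omega, rfl⟩
    · rintro ⟨a, ha, rfl, rfl⟩; exact ⟨⟨ha, ha⟩, by simp⟩
  rw [this, Finset.card_image_of_injective _ (fun a b h => (Prod.mk.injEq _ _ _ _ ▸ h :).1), Finset.card_range]

/-- `c_L(k) = 0` for `|k| ≥ L`. [folklore] -/
theorem fejerCount_eq_zero_of_le {L : ℕ} {k : ℤ} (hk : (L : ℤ) ≤ |k|) : fejerCount L k = 0 := by
  unfold fejerCount
  rw [Finset.card_eq_zero, Finset.filter_eq_empty_iff]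
  intro nm hnm
  simp only [Finset.mem_product, Finset.mem_range] at hnm
  rw [le_abs] at hk
  omega

/-- `c_L(-k) = c_L(k)`. [folklore] -/
theorem fejerCount_neg (L : ℕ) (k : ℤ) : fejerCount L (-k) = fejerCount L k := by
  unfold fejerCount
  refine Finset.card_bij (fun nm _ => (nm.2, nm.1)) ?_ ?_ ?_
  · intro nm hnm
    simp only [Finset.mem_filter, Finset.mem_product] at hnm ⊢
    exact ⟨⟨hnm.1.2, hnm.1.1⟩, by omega⟩
  · intro a _ b _ h
    simp only [Prod.mk.injEq] at h
    exact Prod.ext h.2 h.1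
  · intro nm hnm
    simp only [Finset.mem_filter, Finset.mem_product] at hnm
    exact ⟨(nm.2, nm.1), by simp only [Finset.mem_filter, Finset.mem_product]; exact ⟨⟨hnm.1.2, hnm.1.1⟩, by omega⟩, rfl⟩

/-- `c_L(k) ≥ L - |k|`. [folklore] -/
theorem sub_le_fejerCount (L : ℕ) (k : ℤ) : (L : ℤ) - |k| ≤ fejerCount L k := by
  -- WLOG `k ≥ 0` by symmetry; then `m ↦ (m + k, m)`, `m < L - k`, injects into the fiber
  wlog hk : 0 ≤ k generalizing k
  · have := this (-k) (by omega)
    rwa [fejerCount_neg, abs_neg] at this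
  rw [abs_of_nonneg hk]
  rcases le_or_gt (L : ℤ) k with hkL | hkL
  · have : ((L : ℤ) - k) ≤ 0 := by omega
    exact this.trans (by positivity)
  · unfold fejerCount
    have hsub : (Finset.range ((L : ℤ) - k).toNat).image (fun m => (m + k.toNat, m)) ⊆
        (Finset.range L ×ˢ Finset.range L).filter fun nm => (nm.1 : ℤ) - nm.2 = k := by
      intro nm hnm
      simp only [Finset.mem_image, Finset.mem_range] at hnm
      obtain ⟨m, hm, rfl⟩ := hnm
      simp only [Finset.mem_filter, Finset.mem_product, Finset.mem_range]
      refine ⟨⟨?_, ?_⟩, ?_⟩ <;> omega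
    have hcard := Finset.card_le_card hsub
    rw [Finset.card_image_of_injective _ (fun a b h => by simpa using h), Finset.card_range] at hcard
    omega

/-- The **Dirichlet sum** `D_L(u) = ∑_{n<L} e^{inu}`. [folklore] -/
def dirichletSum (L : ℕ) (u : ℝ) : ℂ := ∑ n ∈ Finset.range L, Complex.exp ((n : ℝ) * u * I)

/-- **The Fejér kernel** `f_L(u) = |D_L(u)|² / L = ∑_{|k|<L} (1 - |k|/L) cos(ku)` (see
`fejerKernel_eq_sum_cos`). [folklore] -/
def fejerKernel (L : ℕ) (u : ℝ) : ℝ := ‖dirichletSum L u‖ ^ 2 / L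

/-- `f_L ≥ 0`. [folklore] -/
theorem fejerKernel_nonneg (L : ℕ) (u : ℝ) : 0 ≤ fejerKernel L u := by unfold fejerKernel; positivity

/-- `|D_L| ≤ L`. [folklore] -/
theorem norm_dirichletSum_le (L : ℕ) (u : ℝ) : ‖dirichletSum L u‖ ≤ L := by
  unfold dirichletSum
  refine (norm_sum_le _ _).trans ?_
  have : ∀ n ∈ Finset.range L, ‖Complex.exp ((n : ℝ) * u * I)‖ = 1 := fun n _ => by
    rw [show ((n : ℝ) : ℂ) * u * I = ((n * u : ℝ) : ℂ) * I by push_cast; ring, Complex.norm_exp_ofReal_mul_I]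
  rw [Finset.sum_congr rfl this]
  simp

/-- `f_L ≤ L`. [folklore] -/
theorem fejerKernel_le (L : ℕ) (u : ℝ) : fejerKernel L u ≤ L := by
  rcases Nat.eq_zero_or_pos L with rfl | hL
  · simp [fejerKernel]
  · unfold fejerKernel
    have hL' : (0 : ℝ) < L := by exact_mod_cast hL
    rw [div_le_iff₀ hL']
    have h := norm_dirichletSum_le L u
    have h0 := norm_nonneg (dirichletSum L u)
    nlinarith

/-- **`|D_L(u)|² = ∑_{|k| ≤ L} c_L(k) e^{iku}`** (autocorrelation). [folklore] -/
theorem normSq_dirichletSum_eq (L : ℕ) (u : ℝ) :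
    ((‖dirichletSum L u‖ ^ 2 : ℝ) : ℂ) = ∑ k ∈ Finset.Icc (-(L : ℤ)) L, (fejerCount L k : ℂ) * Complex.exp ((k : ℝ) * u * I) := by
  rw [← Complex.normSq_eq_norm_sq, ← Complex.mul_conj, dirichletSum, map_sum, Finset.sum_mul_sum]
  have : ∀ n ∈ Finset.range L, ∀ m ∈ Finset.range L,
      Complex.exp ((n : ℝ) * u * I) * conj (Complex.exp ((m : ℝ) * u * I)) = Complex.exp ((((n : ℤ) - m : ℤ) : ℝ) * u * I) := by
    intro n _ m _
    rw [← Complex.exp_conj, ← Complex.exp_add]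
    congr 1
    simp only [map_mul, Complex.conj_ofReal, Complex.conj_I]
    push_cast
    ring
  rw [Finset.sum_congr rfl fun n hn => Finset.sum_congr rfl fun m hm => this n hn m hm,
    sum_range_sum_range_sub_eq (fun k : ℤ => Complex.exp ((k : ℝ) * u * I)) L]
  refine Finset.sum_congr rfl fun k _ => ?_
  rw [nsmul_eq_mul]

/-- **`f_L(u) = (1/L) ∑_{|k| ≤ L} c_L(k) cos(ku) = ∑_{|k|<L} (1 - |k|/L) cos(ku)`.** [folklore] -/
theorem fejerKernel_eq_sum_cos (L : ℕ) (u : ℝ) :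
    fejerKernel L u = (∑ k ∈ Finset.Icc (-(L : ℤ)) L, (fejerCount L k : ℝ) * Real.cos (k * u)) / L := by
  unfold fejerKernel
  congr 1
  have h := congrArg Complex.re (normSq_dirichletSum_eq L u)
  rw [Complex.ofReal_re, Complex.re_sum] at h
  rw [h]
  refine Finset.sum_congr rfl fun k _ => ?_
  rw [show ((k : ℝ) : ℂ) * u * I = ((k * u : ℝ) : ℂ) * I by push_cast; ring,
    show ((fejerCount L k : ℕ) : ℂ) = ((fejerCount L k : ℝ) : ℂ) by push_cast; rfl, Complex.re_ofReal_mul,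
    Complex.exp_ofReal_mul_I_re]

/-- `D_L` as a geometric sum in `e^{iu}`. [folklore] -/
theorem dirichletSum_eq_geom (L : ℕ) (u : ℝ) : dirichletSum L u = ∑ n ∈ Finset.range L, Complex.exp (u * I) ^ n := by
  unfold dirichletSum
  refine Finset.sum_congr rfl fun n _ => ?_
  rw [← Complex.exp_nat_mul]
  congr 1
  push_cast
  ring

/-- `e^{iu} = 1 ↔ sin(u/2) = 0` (in the form used here: `‖e^{iu} - 1‖ = 2|sin(u/2)|`). [folklore] -/
theorem norm_exp_mul_I_sub_one (u : ℝ) : ‖Complex.exp (u * I) - 1‖ = 2 * |Real.sin (u / 2)| := by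
  rw [mul_comm, Complex.norm_exp_I_mul_ofReal_sub_one, Real.norm_eq_abs, abs_mul, abs_two]

/-- **Closed form**: `|D_L(u)| = |sin(Lu/2)| / |sin(u/2)|` for `sin(u/2) ≠ 0`. [folklore] -/
theorem norm_dirichletSum_eq {L : ℕ} {u : ℝ} (hu : Real.sin (u / 2) ≠ 0) :
    ‖dirichletSum L u‖ = |Real.sin (L * u / 2)| / |Real.sin (u / 2)| := by
  have hne : Complex.exp (u * I) ≠ 1 := by
    intro h
    have := norm_exp_mul_I_sub_one u
    rw [h, sub_self, norm_zero] at this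
    exact hu (abs_eq_zero.1 (by linarith))
  rw [dirichletSum_eq_geom, geom_sum_eq hne, norm_div, ← Complex.exp_nat_mul,
    show (L : ℂ) * (u * I) = ((L * u : ℝ) : ℂ) * I by push_cast; ring, norm_exp_mul_I_sub_one, norm_exp_mul_I_sub_one]
  rw [mul_div_mul_left _ _ (two_ne_zero)]

/-- **Jordan's inequality in the form `|u|/π ≤ |sin(u/2)|` for `|u| ≤ π`.** [folklore] -/
private theorem jordan_abs_sin_half {u : ℝ} (hu : |u| ≤ Real.pi) : |u| / Real.pi ≤ |Real.sin (u / 2)| := by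
  -- reduce to `u ≥ 0` by oddness
  wlog h0 : 0 ≤ u generalizing u
  · have := this (u := -u) (by rwa [abs_neg]) (by linarith)
    rwa [abs_neg, neg_div, Real.sin_neg, abs_neg] at this
  rw [abs_of_nonneg h0] at hu ⊢
  have h1 : 2 / Real.pi * (u / 2) ≤ Real.sin (u / 2) := Real.mul_le_sin (by linarith) (by linarith)
  have h2 : 2 / Real.pi * (u / 2) = u / Real.pi := by ring
  rw [h2] at h1
  exact h1.trans (le_abs_self _)

/-- **Decay of the Fejér kernel**: `f_L(u) ≤ π² / (L u²)` for `0 < |u| ≤ π`, `L ≥ 1`. [folklore] -/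
theorem fejerKernel_le_div_sq {L : ℕ} (hL : 1 ≤ L) {u : ℝ} (hu0 : u ≠ 0) (hu : |u| ≤ Real.pi) :
    fejerKernel L u ≤ Real.pi ^ 2 / (L * u ^ 2) := by
  have hL' : (0 : ℝ) < L := by exact_mod_cast hL
  have hsin : |u| / Real.pi ≤ |Real.sin (u / 2)| := jordan_abs_sin_half hu
  have hupos : 0 < |u| / Real.pi := div_pos (abs_pos.2 hu0) Real.pi_pos
  have hs0 : Real.sin (u / 2) ≠ 0 := fun h => by rw [h, abs_zero] at hsin; linarith
  unfold fejerKernel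
  rw [norm_dirichletSum_eq hs0, div_pow, div_div, div_le_div_iff₀ (by positivity) (by positivity)]
  -- `sin²(Lu/2) · L u² ≤ π² · (sin²(u/2) L)`
  have h1 : |Real.sin (L * u / 2)| ^ 2 ≤ 1 := by
    rw [sq_abs]; exact Real.sin_sq_le_one _
  have h2 : (|u| / Real.pi) ^ 2 ≤ |Real.sin (u / 2)| ^ 2 := pow_le_pow_left₀ hupos.le hsin 2
  rw [div_pow, sq_abs] at h2
  rw [div_le_iff₀ (by positivity)] at h2
  have h3 : 0 ≤ |Real.sin (u / 2)| ^ 2 * L := by positivity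
  calc |Real.sin (L * u / 2)| ^ 2 * (L * u ^ 2) ≤ 1 * (L * u ^ 2) := by gcongr
    _ = u ^ 2 * L := by ring
    _ ≤ |Real.sin (u / 2)| ^ 2 * Real.pi ^ 2 * L := by gcongr
    _ = Real.pi ^ 2 * (|Real.sin (u / 2)| ^ 2 * L) := by ring

/-- `f_L(0) = L`. [folklore] -/
theorem fejerKernel_zero (L : ℕ) : fejerKernel L 0 = L := by
  unfold fejerKernel dirichletSum
  simp only [Complex.ofReal_zero, mul_zero, zero_mul, Complex.exp_zero, Finset.sum_const, Finset.card_range,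
    nsmul_eq_mul, mul_one]
  rw [Complex.norm_natCast]
  rcases Nat.eq_zero_or_pos L with rfl | hL
  · simp
  · have : (L : ℝ) ≠ 0 := by exact_mod_cast hL.ne'
    field_simp

/-- **Scaling of the Fejér kernel**: `f_{λℓ}(u) ≤ (π²/4) λ f_ℓ(λu)` for `|u| ≤ π`, `ℓ, λ ≥ 1`. [folklore] -/
theorem fejerKernel_mul_le {ℓ lam : ℕ} (hℓ : 1 ≤ ℓ) (hlam : 1 ≤ lam) {u : ℝ} (hu : |u| ≤ Real.pi) :
    fejerKernel (lam * ℓ) u ≤ Real.pi ^ 2 / 4 * lam * fejerKernel ℓ (lam * u) := by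
  have hℓ' : (0 : ℝ) < ℓ := by exact_mod_cast hℓ
  have hlam' : (1 : ℝ) ≤ lam := by exact_mod_cast hlam
  have hπ : (4 : ℝ) ≤ Real.pi ^ 2 := by nlinarith [Real.two_le_pi]
  by_cases hs : Real.sin (u / 2) = 0
  · -- then `u = 0`
    have hu0 : u = 0 := by
      by_contra hne
      have := jordan_abs_sin_half hu
      rw [hs, abs_zero] at this
      exact absurd this (not_le.2 (div_pos (abs_pos.2 hne) Real.pi_pos))
    subst hu0
    rw [mul_zero, fejerKernel_zero, fejerKernel_zero]
    push_cast
    have hprod : (0 : ℝ) ≤ lam * ℓ := by positivity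
    nlinarith
  by_cases hs' : Real.sin (lam * u / 2) = 0
  · -- then `sin(λℓu/2) = 0` too and the left side vanishes
    have h0 : Real.sin ((lam * ℓ : ℕ) * u / 2) = 0 := by
      obtain ⟨n, hn⟩ := Real.sin_eq_zero_iff.1 hs'
      rw [Real.sin_eq_zero_iff]
      refine ⟨ℓ * n, ?_⟩
      push_cast
      calc (ℓ : ℝ) * n * Real.pi = ℓ * (n * Real.pi) := by ring
        _ = ℓ * (lam * u / 2) := by rw [hn]
        _ = lam * ℓ * u / 2 := by ring
    unfold fejerKernel
    rw [norm_dirichletSum_eq hs, h0, abs_zero, zero_div]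
    simp only [ne_eq, OfNat.ofNat_ne_zero, not_false_eq_true, zero_pow, zero_div]
    positivity
  · unfold fejerKernel
    rw [norm_dirichletSum_eq hs, norm_dirichletSum_eq hs',
      show ((lam * ℓ : ℕ) : ℝ) * u / 2 = ℓ * (lam * u) / 2 by push_cast; ring]
    rw [div_pow, div_pow, div_div, div_div]
    -- `A/(s² λℓ) ≤ (π²/4) λ A/(t² ℓ)` with `A = sin²(ℓλu/2)`, `s = |sin(u/2)| ≥ |u|/π`, `t = |sin(λu/2)| ≤ λ|u|/2`
    have hA : 0 ≤ |Real.sin (ℓ * (lam * u) / 2)| ^ 2 := by positivity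
    have hspos : 0 < |Real.sin (u / 2)| := abs_pos.2 hs
    have htpos : 0 < |Real.sin (lam * u / 2)| := abs_pos.2 hs'
    have hsl : |u| / Real.pi ≤ |Real.sin (u / 2)| := jordan_abs_sin_half hu
    have htl : |Real.sin (lam * u / 2)| ≤ lam * |u| / 2 := by
      calc |Real.sin (lam * u / 2)| ≤ |lam * u / 2| := Real.abs_sin_le_abs
        _ = lam * |u| / 2 := by rw [abs_div, abs_mul, abs_of_nonneg (by positivity : (0 : ℝ) ≤ lam), abs_two]
    rw [div_le_iff₀ (by positivity), show Real.pi ^ 2 / 4 * lam * (|Real.sin (ℓ * (lam * u) / 2)| ^ 2 /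
        (|Real.sin (lam * u / 2)| ^ 2 * ℓ)) * (|Real.sin (u / 2)| ^ 2 * ((lam * ℓ : ℕ) : ℝ)) =
        |Real.sin (ℓ * (lam * u) / 2)| ^ 2 * (Real.pi ^ 2 / 4 * lam ^ 2 * |Real.sin (u / 2)| ^ 2 / |Real.sin (lam * u / 2)| ^ 2) by
      push_cast; field_simp]
    refine le_mul_of_one_le_right hA ?_
    rw [le_div_iff₀ (by positivity), one_mul]
    have h1 : |Real.sin (lam * u / 2)| ^ 2 ≤ (lam * |u| / 2) ^ 2 := pow_le_pow_left₀ htpos.le htl 2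
    have h2 : (|u| / Real.pi) ^ 2 ≤ |Real.sin (u / 2)| ^ 2 := pow_le_pow_left₀ (by positivity) hsl 2
    have hπpos : 0 < Real.pi := Real.pi_pos
    calc |Real.sin (lam * u / 2)| ^ 2 ≤ (lam * |u| / 2) ^ 2 := h1
      _ = Real.pi ^ 2 / 4 * lam ^ 2 * (|u| / Real.pi) ^ 2 := by field_simp; ring
      _ ≤ Real.pi ^ 2 / 4 * lam ^ 2 * |Real.sin (u / 2)| ^ 2 := by gcongr

/-- **Discrete mass of the Fejér kernel**: `∑_{t ∈ ℤ/Λℤ} f_L(2πt/Λ) = Λ` for `L < Λ` (only the `k = 0`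
coefficient survives the character sum). [folklore] -/
theorem sum_fejerKernel_zmod {L Λ : ℕ} [NeZero Λ] (hL : 1 ≤ L) (hLΛ : L < Λ) :
    ∑ t : ZMod Λ, fejerKernel L (2 * Real.pi * t.val / Λ) = Λ := by
  have hL' : (L : ℝ) ≠ 0 := by exact_mod_cast (show L ≠ 0 by omega)
  have hΛ : (Λ : ℝ) ≠ 0 := by exact_mod_cast NeZero.ne Λ
  simp only [fejerKernel_eq_sum_cos, ← Finset.sum_div]
  rw [div_eq_iff hL', Finset.sum_comm]
  -- the character sums `∑_t cos(2π k t/Λ) = Λ 𝟙_{Λ ∣ k}`; only `k = 0` contributes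
  have hchar : ∀ k : ℤ, ∑ t : ZMod Λ, Real.cos (k * (2 * Real.pi * t.val / Λ)) =
      if (Λ : ℤ) ∣ k then (Λ : ℝ) else 0 := by
    intro k
    -- `cos(2πkt/Λ) = Re e(k̄ t)` with `e` the standard character of `ℤ/Λℤ`
    have hre : ∀ t : ZMod Λ, Real.cos (k * (2 * Real.pi * t.val / Λ)) = ((ZMod.stdAddChar ((k : ZMod Λ) * t) : ℂ)).re := by
      intro t
      rw [stdAddChar_re]
      -- `((k̄ t).val : ℝ)` vs `k t.val`: differ by a multiple of `Λ`
      have : ∃ m : ℤ, (2 * Real.pi * (((k : ZMod Λ) * t).val : ℕ) / Λ : ℝ) = k * (2 * Real.pi * t.val / Λ) + m * (2 * Real.pi) := by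
        have hv : ((((k : ZMod Λ) * t).val : ℕ) : ℤ) = (k * t.val) % Λ := by
          rw [ZMod.val_mul]
          push_cast
          rw [ZMod.val_intCast, Int.mul_emod, Int.emod_emod_of_dvd _ (dvd_refl _), ← Int.mul_emod]
        refine ⟨-((k * t.val) / Λ), ?_⟩
        have h1 : ((((k : ZMod Λ) * t).val : ℕ) : ℝ) = ((k * t.val % Λ : ℤ) : ℝ) := by exact_mod_cast hv
        rw [h1, Int.emod_def]
        push_cast
        field_simp
        ring
      obtain ⟨m, hm⟩ := this
      rw [hm, Real.cos_add_int_mul_two_pi]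
    simp only [hre, ← Complex.re_sum]
    have hsum : ∑ t : ZMod Λ, (ZMod.stdAddChar ((k : ZMod Λ) * t) : ℂ) = if (k : ZMod Λ) = 0 then (Λ : ℂ) else 0 := by
      simp_rw [mul_comm (k : ZMod Λ)]
      rw [AddChar.sum_mulShift _ (ZMod.isPrimitive_stdAddChar Λ), ZMod.card, Nat.cast_ite, Nat.cast_zero]
    rw [hsum]
    by_cases hdk : (Λ : ℤ) ∣ k
    · rw [if_pos ((ZMod.intCast_zmod_eq_zero_iff_dvd k Λ).2 hdk), if_pos hdk]; simp
    · rw [if_neg (fun h => hdk ((ZMod.intCast_zmod_eq_zero_iff_dvd k Λ).1 h)), if_neg hdk]; simp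
  simp only [← Finset.mul_sum, hchar, mul_ite, mul_zero]
  -- only `k = 0` has `Λ ∣ k` and a nonzero count
  rw [Finset.sum_ite, Finset.sum_const_zero, add_zero]
  have hfilter : ∀ k ∈ (Finset.Icc (-(L : ℤ)) L).filter (fun k => (Λ : ℤ) ∣ k), k ≠ 0 → (fejerCount L k : ℝ) * Λ = 0 := by
    intro k hk hk0
    simp only [Finset.mem_filter, Finset.mem_Icc] at hk
    rw [fejerCount_eq_zero_of_le]
    · simp
    · obtain ⟨c, hc⟩ := hk.2
      have hc0 : c ≠ 0 := by rintro rfl; simp at hc; exact hk0 hc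
      rw [hc, abs_mul, Nat.abs_cast]
      have : (1 : ℤ) ≤ |c| := Int.one_le_abs hc0
      have hΛL : (L : ℤ) < Λ := by exact_mod_cast hLΛ
      nlinarith
  rw [Finset.sum_eq_single_of_mem 0 ?_ (fun k hk hk0 => hfilter k hk hk0), fejerCount_zero]
  · ring
  · simp only [Finset.mem_filter, Finset.mem_Icc]
    exact ⟨⟨by omega, by omega⟩, dvd_zero _⟩

end OneDim

/-! ### Part 2. The separable `d`-dimensional Fejér kernel -/

section MultiDim

variable {d : ℕ}

variable (d) in
/-- The **`d`-dimensional Fejér weights** `F_L(x) = ∏ᵢ c_L(xᵢ)/L = ∏ᵢ (1 - |xᵢ|/L)_+`. [folklore] -/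
def fejerBox (L : ℕ) (x : Site d) : ℝ := ∏ i, (fejerCount L (x i) : ℝ) / L

variable (d) in
/-- Its Fourier transform, the **separable Fejér kernel** `F̂_L(p) = ∏ᵢ f_L(pᵢ)`. [folklore] -/
def fejerBoxHat (L : ℕ) (p : Fin d → ℝ) : ℝ := ∏ i, fejerKernel L (p i)

/-- `F_L ≥ 0`. [folklore] -/
theorem fejerBox_nonneg (L : ℕ) (x : Site d) : 0 ≤ fejerBox d L x :=
  Finset.prod_nonneg fun i _ => by positivity

/-- `F_L ≤ 1`. [folklore] -/
theorem fejerBox_le_one (L : ℕ) (x : Site d) : fejerBox d L x ≤ 1 := by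
  unfold fejerBox
  refine Finset.prod_le_one (fun i _ => by positivity) fun i _ => ?_
  rcases Nat.eq_zero_or_pos L with rfl | hL
  · simp
  · rw [div_le_one (by exact_mod_cast hL)]
    exact_mod_cast fejerCount_le L (x i)

/-- `F_L(0) = 1` (`L ≥ 1`). [folklore] -/
theorem fejerBox_zero {L : ℕ} (hL : 1 ≤ L) : fejerBox d L 0 = 1 := by
  unfold fejerBox
  have hL' : (L : ℝ) ≠ 0 := by exact_mod_cast (show L ≠ 0 by omega)
  simp [fejerCount_zero, hL']

/-- `F_L(-x) = F_L(x)`. [folklore] -/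
theorem fejerBox_neg (L : ℕ) (x : Site d) : fejerBox d L (-x) = fejerBox d L x := by
  unfold fejerBox
  simp [fejerCount_neg]

/-- `F_L` vanishes off `Λ_L`. [folklore] -/
theorem fejerBox_eq_zero_of_not_mem {L : ℕ} {x : Site d} (hx : x ∉ box d L) : fejerBox d L x = 0 := by
  rw [mem_box] at hx
  push Not at hx
  obtain ⟨i, hi⟩ := hx
  unfold fejerBox
  refine Finset.prod_eq_zero (Finset.mem_univ i) ?_
  rw [fejerCount_eq_zero_of_le]
  · simp
  · rw [le_abs]; omega

/-- **`F_L ≥ 2^{-d}` on the half box**: if `2|xᵢ| ≤ L` for all `i` then `F_L(x) ≥ 2^{-d}`. [folklore] -/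
theorem fejerBox_ge_of_two_mul_le {L : ℕ} (hL : 1 ≤ L) {x : Site d} (hx : ∀ i, 2 * |x i| ≤ L) :
    (1 / 2 : ℝ) ^ d ≤ fejerBox d L x := by
  unfold fejerBox
  have hL' : (0 : ℝ) < L := by exact_mod_cast hL
  have hcard : ((1 / 2 : ℝ)) ^ d = ∏ _i : Fin d, (1 / 2 : ℝ) := by simp
  rw [hcard]
  refine Finset.prod_le_prod (fun i _ => by norm_num) fun i _ => ?_
  rw [le_div_iff₀ hL']
  have h1 : (L : ℤ) - |x i| ≤ fejerCount L (x i) := sub_le_fejerCount L (x i)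
  have h2 : ((L : ℤ) : ℝ) - (|x i| : ℤ) ≤ (fejerCount L (x i) : ℝ) := by exact_mod_cast h1
  have h3 : (2 * |x i| : ℝ) ≤ L := by exact_mod_cast hx i
  push_cast at h2 h3
  linarith

/-- **`F̂_L` is the cosine transform of `F_L`**: `F̂_L(p) = ∑_{x ∈ Λ_L} F_L(x) cos(p·x)` (`L ≥ 1`;
the product of the one-dimensional autocorrelation identities, imaginary parts cancelling by the
evenness of the counts). [folklore] -/
theorem fejerBoxHat_eq_sum {L : ℕ} (hL : 1 ≤ L) (p : Fin d → ℝ) :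
    fejerBoxHat d L p = ∑ x ∈ box d L, fejerBox d L x * Real.cos (phase d p x) := by
  have hL' : (L : ℝ) ≠ 0 := by exact_mod_cast (show L ≠ 0 by omega)
  -- complex form of each factor: `f_L(u) = (1/L) ∑_k c_L(k) e^{iku}`
  have h1 : ∀ u : ℝ, (fejerKernel L u : ℂ) = ∑ k ∈ Finset.Icc (-(L : ℤ)) L, ((fejerCount L k : ℝ) / L : ℂ) * Complex.exp ((k : ℝ) * u * I) := by
    intro u
    unfold fejerKernel
    rw [Complex.ofReal_div, normSq_dirichletSum_eq, Finset.sum_div]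
    refine Finset.sum_congr rfl fun k _ => ?_
    push_cast
    ring
  have h2 : (fejerBoxHat d L p : ℂ) = ∑ x ∈ box d L, (fejerBox d L x : ℂ) * Complex.exp ((phase d p x : ℂ) * I) := by
    unfold fejerBoxHat
    push_cast
    simp only [h1]
    rw [Finset.prod_univ_sum]
    refine Finset.sum_congr (by rfl) fun x _ => ?_
    rw [fejerBox, phase]
    push_cast
    rw [Finset.prod_mul_distrib, Finset.sum_mul, Complex.exp_sum]
    congr 1
    refine Finset.prod_congr rfl fun i _ => ?_
    congr 1
    ring
  have h3 := congrArg Complex.re h2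
  rw [Complex.ofReal_re, Complex.re_sum] at h3
  rw [h3]
  refine Finset.sum_congr rfl fun x _ => ?_
  rw [Complex.re_ofReal_mul, Complex.exp_ofReal_mul_I_re]

/-- `F̂_L ≥ 0`. [folklore] -/
theorem fejerBoxHat_nonneg (L : ℕ) (p : Fin d → ℝ) : 0 ≤ fejerBoxHat d L p :=
  Finset.prod_nonneg fun i _ => fejerKernel_nonneg L (p i)

/-- `F̂_L ≤ L^d`. [folklore] -/
theorem fejerBoxHat_le (L : ℕ) (p : Fin d → ℝ) : fejerBoxHat d L p ≤ (L : ℝ) ^ d := by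
  unfold fejerBoxHat
  rw [show (L : ℝ) ^ d = ∏ _i : Fin d, (L : ℝ) by simp]
  exact Finset.prod_le_prod (fun i _ => fejerKernel_nonneg L (p i)) fun i _ => fejerKernel_le L (p i)

/-- **Scaling of `F̂`**: `F̂_{λℓ}(p) ≤ (π²/4)^d λ^d F̂_ℓ(λp)` for `p ∈ [-π, π]^d`. [folklore] -/
theorem fejerBoxHat_mul_le {ℓ lam : ℕ} (hℓ : 1 ≤ ℓ) (hlam : 1 ≤ lam) {p : Fin d → ℝ} (hp : ∀ i, |p i| ≤ Real.pi) :
    fejerBoxHat d (lam * ℓ) p ≤ (Real.pi ^ 2 / 4 * lam) ^ d * fejerBoxHat d ℓ (fun i => lam * p i) := by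
  unfold fejerBoxHat
  rw [show (Real.pi ^ 2 / 4 * lam : ℝ) ^ d = ∏ _i : Fin d, (Real.pi ^ 2 / 4 * lam : ℝ) by simp, ← Finset.prod_mul_distrib]
  exact Finset.prod_le_prod (fun i _ => fejerKernel_nonneg _ _) fun i _ => fejerKernel_mul_le hℓ hlam (hp i)

/-- **Discrete mass of `F̂`**: `∑_{k ∈ (ℤ/Λℤ)^d} F̂_L(2πk/Λ) = Λ^d` for `1 ≤ L < Λ`. [folklore] -/
theorem sum_fejerBoxHat_torus {L Λ : ℕ} [NeZero Λ] (hL : 1 ≤ L) (hLΛ : L < Λ) :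
    ∑ k : TorusSite d Λ, fejerBoxHat d L (latticeMomentum Λ k) = (Λ : ℝ) ^ d := by
  unfold fejerBoxHat latticeMomentum
  have key := Finset.prod_univ_sum (t := fun _ : Fin d => (Finset.univ : Finset (ZMod Λ)))
    (f := fun _ t => fejerKernel L (2 * Real.pi * (t.val : ℝ) / Λ))
  simp only [Fintype.piFinset_univ, sum_fejerKernel_zmod hL hLΛ, Finset.prod_const, Finset.card_univ,
    Fintype.card_fin] at key
  exact key.symm

end MultiDim

end Literature.Probability.LatticeModels

end
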